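import Summits.BirchSwinnertonDyer.BirchSwinnertonDyer.Theorems.ByReductionTypeAtTwoRankOneAtTwoOffBigImageOddLocalDefs
import Literature.NumberTheory.EllipticCurves.ComplexMultiplicationDeuringFrobeniusProofs
import Literature.NumberTheory.EllipticCurves.TwoTorsionGaloisActionProofs
import Literature.NumberTheory.EllipticCurves.TwoAdicImageSurjectivityModTwoProofs
import Literature.NumberTheory.EllipticCurves.TwoAdicImageNonSurjectiveFamiliesProofs
import Literature.NumberTheory.EllipticCurves.LocalTorsionMultiplicativeProofs
import Literature.NumberTheory.EllipticCurves.HeegnerPointsKolyvaginPrimaryCongruenceProofs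
import HarnessLib

/-!
# Route `ByReductionTypeAtTwo`, crux `RankOneAtTwoOffBigImageOddLocal` (stmt-BirchSwinnertonDyer-23716), line
# `refined_kolyvagin_tamagawa_shift_at_two` — ENGINE PORT `c₀ ↦ h₀` (regular element), §A the level-1 dictionary filter ↔ Galois

Lead prover `prover-cruxlead-stmt-BirchSwinnertonDyer-23716-g0` (2026-08-28), landing the crux-plan g6 ENGINE QUARRY
`Cruxes/RankOneAtTwoOffBigImageOddLocal/RefinedKolyvaginEngineG6.lean` (planner `cruxplan-…-23716-refined-kolyvag-9ff2fe475f-g6`, v4, 1631 lines,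
rc 0 / 0 sorry; `Cruxes/` files are not importable, so the lead COPIES the proofs into `Theorems/` — card «LEAD QUICKSTART (g6)» Q2 #3 / Q4) as
`--supports stmt-BirchSwinnertonDyer-23716` helpers.  The engine port is kernel-closable item #3 of the pen's order (PEN-PICK-23716 ADD-4): replace
complex conjugation `c₀` by a REGULAR element `h₀` (det `−1`, trace `0`, odd mod `2`) in the tree's equivariant-Čebotarev engine
`GenusExact.exists_kolyvaginPrime_gt_two_of_galoisElement`, so that Kolyvagin primes with LOSSLESS local Kummer maps exist on the `Δ > 0` cells of the
S₃-locus (where `ρ̄₂(c₀) = 1` loses the top bit — residual 24883), feeding the line's filtered stubs `…WithOn Φ_reg Ω` (card #7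
`regular-frobenius-kolyvagin-primes-pos-disc`).  THIS FILE: §A — `sign_permGal_eq_one_iff` (for `W` globally minimal, `ℓ ∤ 2Δ_min`, ANY arithmetic Frobenius `σ` at `𝔓 ∣ ℓ`: `sign(σ|E[2]) = +1 ↔ IsSquare (Δ_min mod ℓ)`),
`exists_smul_twoTorsion_ne_of_not_isSquare` (the filter ⟹ R1's hypothesis «`σ` moves a `2`-torsion point» for EVERY Frobenius above `ℓ`),
`frobNontrivialModTwo_of_not_isSquare` (card #7's `FrobNontrivialModTwo` body), `not_isSquare_of_transposition` (converse), and `regularAtTwo_iff` relating the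
line's registered filter `OffBigImageOddLocalAtTwo.RegularAtTwo` (`…Defs.lean`, p643983) to `¬ IsSquare (Δ_min mod ℓ)`; ingredient `smul_eq_neg_of_isArithFrobAt`
(non-split companion of `DeuringLadic.smul_eq_self_of_isArithFrobAt`).

Statements and proofs are the quarry's VERBATIM (namespace moved to `…Theorems.OffBigImageOddLocalAtTwo.Engine`).  Nothing here proves the crux,
`BSDp W 2`, BSD or the summit; no registered stub is discharged (engine inputs only).  BSD is not proved.

Refs: [GrossLMS1991] §3 (3.1)–(3.3), §9; [McCallumLMS1991] §3; [SilvermanAEC2009] III.§1, III.§8 (Weil pairing), VII–VIII; Dokchitser–Dokchitser (2012);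
Serre (1972) §5.3.
-/

set_option linter.dupNamespace false -- tree convention: `Summit.BirchSwinnertonDyer.BirchSwinnertonDyer.Theorems` (summit = sub-problem)
set_option autoImplicit false

noncomputable section

namespace Summit.BirchSwinnertonDyer.BirchSwinnertonDyer.Theorems.OffBigImageOddLocalAtTwo.Engine

/-! ## §A  Level-1 dictionary: `RegularAtTwo` (Legendre symbol of `Δ_min`) ↔ Frobenius parity on `E[2]` -/

section DictionaryA

open WeierstrassCurve NumberField IsDedekindDomain Field
open Literature.NumberTheory.GaloisRepresentations Literature.NumberTheory.EllipticCurves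
open Literature.NumberTheory.EllipticCurves.DokchitserDokchitser2012
open Literature.NumberTheory.EllipticCurves.DeuringLadic

/-- **Companion of the tree's `DeuringLadic.smul_eq_self_of_isArithFrobAt` (non-split case).** `p` odd prime, `p ∤ d`,
`d` a NON-square mod `p`, `s² = d`, `σ` an arithmetic Frobenius at `𝔓 ∣ p`: `σ s = -s`
(`σ s ≡ s^p = s·d^{(p-1)/2} ≡ -s (mod 𝔓)` by Euler's criterion; `σ s = s` would give `2s ∈ 𝔓`, `4d ∈ 𝔓 ∩ ℤ = pℤ`). [folklore] -/
theorem smul_eq_neg_of_isArithFrobAt {p : ℕ} (hp : p.Prime) (h2 : p ≠ 2) {d : ℤ}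
    (hpd : ¬ (p : ℤ) ∣ d) (hsq : ¬ IsSquare ((d : ℤ) : ZMod p)) {s : AlgebraicClosure ℚ}
    (hs : s ^ 2 = (d : AlgebraicClosure ℚ)) {v : HeightOneSpectrum (𝓞 ℚ)}
    (hv : (Rat.HeightOneSpectrum.primesEquiv v : ℕ) = p) {𝔓 : Ideal (absIntegers (𝓞 ℚ) ℚ)}
    (h𝔓 : 𝔓 ∈ v.primesAbove) {σ : absoluteGaloisGroup ℚ} (hσ : IsArithFrobAt (𝓞 ℚ) σ 𝔓) :
    σ • s = -s := by
  haveI : 𝔓.IsPrime := h𝔓.1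
  haveI : Fact p.Prime := ⟨hp⟩
  have hsi : IsIntegral (𝓞 ℚ) s := by
    refine IsIntegral.of_pow two_pos ?_
    rw [hs, show (d : AlgebraicClosure ℚ) = algebraMap (𝓞 ℚ) (AlgebraicClosure ℚ) (d : 𝓞 ℚ) by
      rw [map_intCast]]
    exact isIntegral_algebraMap
  set x : absIntegers (𝓞 ℚ) ℚ := ⟨s, hsi⟩ with hx
  have hxs : (x : AlgebraicClosure ℚ) = s := rfl
  have hx2 : x ^ 2 = (d : absIntegers (𝓞 ℚ) ℚ) := Subtype.ext (by simp [hxs, hs])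
  have hpv : (p : 𝓞 ℚ) ∈ v.asIdeal := (natCast_mem_asIdeal_iff v p).mpr (by rw [hv])
  have hp𝔓 : (p : absIntegers (𝓞 ℚ) ℚ) ∈ 𝔓 := by
    have := hpv
    rw [h𝔓.2.over, Ideal.mem_under, map_natCast] at this
    exact this
  have hres : v.residueCard = p := residueCard_eq_of_natCast_mem_rat hp hpv
  have hd0 : ((d : ℤ) : ZMod p) ≠ 0 := by
    rwa [Ne, ZMod.intCast_zmod_eq_zero_iff_dvd]
  -- Euler's criterion, non-residue: `p ∣ d ^ (p / 2) + 1`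
  have heuler : (p : ℤ) ∣ d ^ (p / 2) + 1 := by
    rw [← ZMod.intCast_zmod_eq_zero_iff_dvd]
    push_cast
    rcases ZMod.pow_div_two_eq_neg_one_or_one p hd0 with h1 | h1
    · exact absurd ((ZMod.euler_criterion p hd0).mpr h1) hsq
    · rw [h1, neg_add_cancel]
  have hdk : ((d : absIntegers (𝓞 ℚ) ℚ)) ^ (p / 2) + 1 ∈ 𝔓 := by
    obtain ⟨k, hk⟩ := heuler
    have : ((d : absIntegers (𝓞 ℚ) ℚ)) ^ (p / 2) + 1 = (p : absIntegers (𝓞 ℚ) ℚ) * (k : absIntegers (𝓞 ℚ) ℚ) := by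
      have h := congrArg (fun z : ℤ => (z : absIntegers (𝓞 ℚ) ℚ)) hk
      push_cast at h
      exact h
    rw [this]
    exact 𝔓.mul_mem_right _ hp𝔓
  have hodd : p = 2 * (p / 2) + 1 := by
    have := hp.eq_two_or_odd'.resolve_left h2
    obtain ⟨k, hk⟩ := this
    omega
  -- `x ^ p + x ∈ 𝔓`
  have hxp : x ^ p + x ∈ 𝔓 := by
    have : x ^ p + x = x * (((d : absIntegers (𝓞 ℚ) ℚ)) ^ (p / 2) + 1) := by
      conv_lhs => rw [hodd]
      rw [pow_succ, pow_mul, hx2]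
      ring
    rw [this]
    exact 𝔓.mul_mem_left _ hdk
  -- hence `σ • x + x ∈ 𝔓`
  have hσx : σ • x + x ∈ 𝔓 := by
    have h := (HeightOneSpectrum.isArithFrobAt_iff_of_mem_primesAbove h𝔓 σ).mp hσ x
    rw [hres] at h
    have : σ • x + x = (σ • x - x ^ p) + (x ^ p + x) := by ring
    rw [this]
    exact 𝔓.add_mem h hxp
  -- `σ • x = ± x`
  have hσd : σ • (d : absIntegers (𝓞 ℚ) ℚ) = d := by
    rw [← MulSemiringAction.toRingHom_apply, map_intCast]
  have hσx2 : (σ • x) ^ 2 = (d : absIntegers (𝓞 ℚ) ℚ) := by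
    rw [← smul_pow', hx2, hσd]
  have hprod : (σ • x + x) * (σ • x - x) = 0 := by
    have : (σ • x + x) * (σ • x - x) = (σ • x) ^ 2 - x ^ 2 := by ring
    rw [this, hσx2, hx2, sub_self]
  rcases mul_eq_zero.mp hprod with h0 | h0
  · -- `σ • x = -x`
    have h1 : σ • x = -x := eq_neg_of_add_eq_zero_left h0
    have h' := congrArg (fun z : absIntegers (𝓞 ℚ) ℚ => (z : AlgebraicClosure ℚ)) h1
    simpa [hxs, integralClosure.coe_smul] using h'
  · -- `σ • x = x`: then `2x ∈ 𝔓`, `4d ∈ 𝔓 ∩ ℤ = pℤ`, impossible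
    exfalso
    have heq : σ • x = x := sub_eq_zero.mp h0
    have h2x : (2 : absIntegers (𝓞 ℚ) ℚ) * x ∈ 𝔓 := by
      have : σ • x + x = (2 : absIntegers (𝓞 ℚ) ℚ) * x := by rw [heq]; ring
      rw [this] at hσx
      exact hσx
    have h4d : ((4 * d : ℤ) : absIntegers (𝓞 ℚ) ℚ) ∈ 𝔓 := by
      have : ((4 * d : ℤ) : absIntegers (𝓞 ℚ) ℚ) = (2 * x) * (2 * x) := by
        push_cast
        rw [← hx2]
        ring
      rw [this]
      exact 𝔓.mul_mem_left _ h2x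
    have h4d' : ((4 * d : ℤ) : 𝓞 ℚ) ∈ v.asIdeal := by
      rw [h𝔓.2.over, Ideal.mem_under, map_intCast]
      exact h4d
    rw [intCast_mem_asIdeal_iff, hv] at h4d'
    have hp' : Prime (p : ℤ) := Nat.prime_iff_prime_int.mp hp
    rcases hp'.dvd_or_dvd h4d' with h4 | hd
    · have : (p : ℤ) ∣ 2 ^ 2 := by norm_num; exact h4
      have h2' := hp'.dvd_of_dvd_pow this
      have : p ∣ 2 := by exact_mod_cast h2'
      exact h2 ((Nat.prime_dvd_prime_iff_eq hp Nat.prime_two).mp this)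
    · exact hpd hd

/-! ### The sign of Frobenius on `E[2]` is the Legendre symbol of the minimal discriminant -/

section SignLegendre

variable (W : WeierstrassCurve ℚ) [W.IsElliptic] [W.IsGloballyMinimal]


/-- `(64 δ)² = 256 Δ_min` in `ℚ̄` (`Δ = 16 δ²`, tree `algebraMap_Δ`; `Δ = Δ_min` for a globally minimal model). -/
theorem delta64_sq :
    (64 * delta W two_ne_zero) ^ 2 = ((256 * minimalDiscriminantInt W : ℤ) : AlgebraicClosure ℚ) := by
  have hΔ := algebraMap_Δ W two_ne_zero
  rw [← cast_minimalDiscriminantInt W, map_intCast] at hΔ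
  push_cast
  linear_combination (-256 : AlgebraicClosure ℚ) * hΔ

omit [W.IsGloballyMinimal] in
/-- `σ (64 δ) = sign(σ|E[2]) · 64 δ` (tree `smul_delta`). -/
theorem smul_delta64 (σ : absoluteGaloisGroup ℚ) :
    σ • (64 * delta W two_ne_zero) =
      ((Equiv.Perm.sign (permGal W two_ne_zero σ) : ℤ) : AlgebraicClosure ℚ) * (64 * delta W two_ne_zero) := by
  have h64 : σ • (64 : AlgebraicClosure ℚ) = 64 := by
    rw [← MulSemiringAction.toRingHom_apply, map_ofNat]
  rw [smul_mul', smul_delta, h64]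
  ring

omit [W.IsGloballyMinimal] in
/-- `64 δ ≠ 0` for an elliptic `W` (its square is `256 Δ_min ≠ 0`). [folklore] -/
theorem delta64_ne_zero : (64 * delta W two_ne_zero) ≠ 0 :=
  mul_ne_zero (by norm_num) (delta_ne_zero W two_ne_zero)

variable {W}

/-- For an odd prime `ℓ`, `256 D` is a square mod `ℓ` iff `D` is. [folklore] -/
theorem isSquare_256_mul_iff {ℓ : ℕ} (hℓ : ℓ.Prime) (hℓ2 : ℓ ≠ 2) (D : ℤ) :
    IsSquare (((256 * D : ℤ)) : ZMod ℓ) ↔ IsSquare ((D : ℤ) : ZMod ℓ) := by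
  haveI : Fact ℓ.Prime := ⟨hℓ⟩
  have h2 : (2 : ZMod ℓ) ≠ 0 := by
    intro h
    have : ((2 : ℤ) : ZMod ℓ) = 0 := by exact_mod_cast h
    rw [ZMod.intCast_zmod_eq_zero_iff_dvd] at this
    have h' : ℓ ∣ 2 := by exact_mod_cast this
    exact hℓ2 ((Nat.prime_dvd_prime_iff_eq hℓ Nat.prime_two).mp h')
  have h16 : (16 : ZMod ℓ) ≠ 0 := by
    rw [show (16 : ZMod ℓ) = 2 ^ 4 by norm_num]
    exact pow_ne_zero 4 h2
  push_cast
  constructor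
  · rintro ⟨t, ht⟩
    refine ⟨t / 16, ?_⟩
    field_simp
    linear_combination ht
  · rintro ⟨t, ht⟩
    exact ⟨16 * t, by rw [ht]; ring⟩

/-- For an odd prime `ℓ ∤ D`, also `ℓ ∤ 256 D`. [folklore] -/
theorem not_dvd_256_mul {ℓ : ℕ} (hℓ : ℓ.Prime) (hℓ2 : ℓ ≠ 2) {D : ℤ} (hD : ¬ (ℓ : ℤ) ∣ D) :
    ¬ (ℓ : ℤ) ∣ 256 * D := by
  intro h
  have hp' : Prime (ℓ : ℤ) := Nat.prime_iff_prime_int.mp hℓ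
  rcases hp'.dvd_or_dvd h with h | h
  · have : (ℓ : ℤ) ∣ 2 ^ 8 := by norm_num; exact h
    have h2' := hp'.dvd_of_dvd_pow this
    have : ℓ ∣ 2 := by exact_mod_cast h2'
    exact hℓ2 ((Nat.prime_dvd_prime_iff_eq hℓ Nat.prime_two).mp this)
  · exact hD h

/-- **Level-1 dictionary (sign = Legendre).** For `W/ℚ` elliptic and globally minimal, `ℓ` an odd prime of good
reduction (`ℓ ∤ Δ_min`), and ANY arithmetic Frobenius `σ` at a prime `𝔓 ∣ ℓ` of `\bar ℤ`: the permutation `σ|E[2]`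
of the three `2`-torsion points is EVEN iff `Δ_min` is a square mod `ℓ`, i.e. `sign(σ|E[2]) = (Δ_min / ℓ)`
(`ℚ(√Δ) ⊂ ℚ(E[2])`, `σ√Δ ≡ √Δ^ℓ`, Euler's criterion). [folklore; Silverman AEC III.§1 (`disc ψ₂ = 16 Δ`),
Dokchitser–Dokchitser 2012 proof of Thm (1)] -/
theorem sign_permGal_eq_one_iff {ℓ : ℕ} (hℓ : ℓ.Prime) (hℓ2 : ℓ ≠ 2)
    (hℓΔ : ¬ (ℓ : ℤ) ∣ minimalDiscriminantInt W) {v : HeightOneSpectrum (𝓞 ℚ)}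
    (hv : (Rat.HeightOneSpectrum.primesEquiv v : ℕ) = ℓ) {𝔓 : Ideal (absIntegers (𝓞 ℚ) ℚ)}
    (h𝔓 : 𝔓 ∈ v.primesAbove) {σ : absoluteGaloisGroup ℚ} (hσ : IsArithFrobAt (𝓞 ℚ) σ 𝔓) :
    Equiv.Perm.sign (permGal W two_ne_zero σ) = 1 ↔
      IsSquare ((minimalDiscriminantInt W : ℤ) : ZMod ℓ) := by
  have h256 := not_dvd_256_mul hℓ hℓ2 hℓΔ
  have hη2 := delta64_sq W
  have hη0 := delta64_ne_zero W
  have hση := smul_delta64 W σ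
  set η := 64 * delta W two_ne_zero with hη
  by_cases hsq : IsSquare ((minimalDiscriminantInt W : ℤ) : ZMod ℓ)
  · have hfix : σ • η = η :=
      smul_eq_self_of_isArithFrobAt hℓ hℓ2 h256 ((isSquare_256_mul_iff hℓ hℓ2 _).mpr hsq) hη2 hv h𝔓 hσ
    refine ⟨fun _ ↦ hsq, fun _ ↦ ?_⟩
    rcases Int.units_eq_one_or (Equiv.Perm.sign (permGal W two_ne_zero σ)) with h1 | h1
    · exact h1
    · exfalso
      rw [hfix, h1] at hση
      apply hη0
      have : (2 : AlgebraicClosure ℚ) * η = 0 := by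
        push_cast at hση
        linear_combination hση
      exact (mul_eq_zero.mp this).resolve_left two_ne_zero
  · have hneg : σ • η = -η :=
      smul_eq_neg_of_isArithFrobAt hℓ hℓ2 h256 (mt (isSquare_256_mul_iff hℓ hℓ2 _).mp hsq) hη2 hv h𝔓 hσ
    refine ⟨fun h1 ↦ ?_, fun h ↦ absurd h hsq⟩
    exfalso
    rw [hneg, h1] at hση
    apply hη0
    have : (2 : AlgebraicClosure ℚ) * η = 0 := by
      push_cast at hση
      linear_combination -hση
    exact (mul_eq_zero.mp this).resolve_left two_ne_zero

/-- `(ℓ) ∈ v` pins the place: `primesEquiv v = ℓ`. -/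
theorem primesEquiv_eq_of_natCast_mem {ℓ : ℕ} (hℓ : ℓ.Prime) {v : HeightOneSpectrum (𝓞 ℚ)}
    (hv : (ℓ : 𝓞 ℚ) ∈ v.asIdeal) : (Rat.HeightOneSpectrum.primesEquiv v : ℕ) = ℓ :=
  (Nat.prime_dvd_prime_iff_eq (Rat.HeightOneSpectrum.primesEquiv v).2 hℓ).mp
    ((natCast_mem_asIdeal_iff v ℓ).mp hv)

/-- Parity facts in `S₃` (kernel `decide`). -/
theorem perm_three_sign_eq_neg_one_of_move_of_fix :
    ∀ p : Equiv.Perm (Fin 3), (∃ i, p i ≠ i) → (∃ j, p j = j) → Equiv.Perm.sign p = -1 := by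
  decide

/-- A permutation of three letters with sign `≠ 1` moves some letter. [folklore] -/
theorem perm_three_exists_move_of_sign_ne_one :
    ∀ p : Equiv.Perm (Fin 3), Equiv.Perm.sign p ≠ 1 → ∃ i, p i ≠ i := by
  decide

/-- **FILTER ⟹ R1's hypothesis.** If `Δ_min` is a NON-square mod the odd good prime `ℓ` (the skeleton's `RegularAtTwo W ℓ`),
then EVERY arithmetic Frobenius `σ` at every `𝔓 ∣ ℓ` moves some `2`-torsion point (`σ|E[2]` is a transposition) —
exactly the hypothesis `∃ v : E[2], h • v ≠ v` of R1 `CyclicTorsionOfRegularElement`. -/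
theorem exists_smul_twoTorsion_ne_of_not_isSquare {ℓ : ℕ} (hℓ : ℓ.Prime) (hℓ2 : ℓ ≠ 2)
    (hℓΔ : ¬ (ℓ : ℤ) ∣ minimalDiscriminantInt W) (hns : ¬ IsSquare ((minimalDiscriminantInt W : ℤ) : ZMod ℓ))
    {v : HeightOneSpectrum (𝓞 ℚ)} (hv : (ℓ : 𝓞 ℚ) ∈ v.asIdeal) {𝔓 : Ideal (absIntegers (𝓞 ℚ) ℚ)}
    (h𝔓 : 𝔓 ∈ v.primesAbove) {σ : absoluteGaloisGroup ℚ} (hσ : IsArithFrobAt (𝓞 ℚ) σ 𝔓) :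
    ∃ P : W.geomTorsion 2, σ • P ≠ P := by
  have hsign : Equiv.Perm.sign (permGal W two_ne_zero σ) ≠ 1 := fun h1 ↦
    hns ((sign_permGal_eq_one_iff hℓ hℓ2 hℓΔ (primesEquiv_eq_of_natCast_mem hℓ hv) h𝔓 hσ).mp h1)
  obtain ⟨i, hi⟩ := perm_three_exists_move_of_sign_ne_one _ hsign
  refine ⟨T W two_ne_zero i, fun h ↦ hi ?_⟩
  rw [← T_permGal] at h
  exact T_injective W two_ne_zero h

/-- **FILTER ⟹ card #7's `FrobNontrivialModTwo W ℓ`** (its body verbatim): some Frobenius above `ℓ` moves a `2`-torsion point. -/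
theorem frobNontrivialModTwo_of_not_isSquare {ℓ : ℕ} (hℓ : ℓ.Prime) (hℓ2 : ℓ ≠ 2)
    (hℓΔ : ¬ (ℓ : ℤ) ∣ minimalDiscriminantInt W) (hns : ¬ IsSquare ((minimalDiscriminantInt W : ℤ) : ZMod ℓ)) :
    ∃ (v : HeightOneSpectrum (𝓞 ℚ)) (𝔓 : Ideal (absIntegers (𝓞 ℚ) ℚ)) (h : absoluteGaloisGroup ℚ),
      (ℓ : 𝓞 ℚ) ∈ v.asIdeal ∧ 𝔓 ∈ v.primesAbove ∧ IsArithFrobAt (𝓞 ℚ) h 𝔓 ∧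
        ∃ P : W.geomTorsion 2, h • P ≠ P := by
  set v : HeightOneSpectrum (𝓞 ℚ) := (Rat.HeightOneSpectrum.primesEquiv).symm ⟨ℓ, hℓ⟩ with hvdef
  have hv : (ℓ : 𝓞 ℚ) ∈ v.asIdeal := by
    rw [natCast_mem_asIdeal_iff, hvdef, Equiv.apply_symm_apply]
  obtain ⟨𝔓, h𝔓⟩ := HeightOneSpectrum.primesAbove_nonempty v
  obtain ⟨σ, hσ⟩ := HeightOneSpectrum.exists_isArithFrobAt_of_mem_primesAbove_holds h𝔓
  exact ⟨v, 𝔓, σ, hv, h𝔓, hσ, exists_smul_twoTorsion_ne_of_not_isSquare hℓ hℓ2 hℓΔ hns hv h𝔓 hσ⟩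

/-- **ENGINE ⟹ FILTER.** If some arithmetic Frobenius `σ` at `𝔓 ∣ ℓ` acts on `E[2]` as a TRANSPOSITION — it moves a
`2`-torsion point and fixes a nonzero one (e.g. `σ ≡ h₀` on `E[2^M]` for a regular involution `h₀`) — then `Δ_min`
is a non-square mod `ℓ` (`RegularAtTwo W ℓ`). -/
theorem not_isSquare_of_transposition {ℓ : ℕ} (hℓ : ℓ.Prime) (hℓ2 : ℓ ≠ 2)
    (hℓΔ : ¬ (ℓ : ℤ) ∣ minimalDiscriminantInt W)
    {v : HeightOneSpectrum (𝓞 ℚ)} (hv : (ℓ : 𝓞 ℚ) ∈ v.asIdeal) {𝔓 : Ideal (absIntegers (𝓞 ℚ) ℚ)}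
    (h𝔓 : 𝔓 ∈ v.primesAbove) {σ : absoluteGaloisGroup ℚ} (hσ : IsArithFrobAt (𝓞 ℚ) σ 𝔓)
    (hmove : ∃ P : W.geomTorsion 2, σ • P ≠ P) (hfix : ∃ P : W.geomTorsion 2, P ≠ 0 ∧ σ • P = P) :
    ¬ IsSquare ((minimalDiscriminantInt W : ℤ) : ZMod ℓ) := by
  intro hsq
  have h1 : Equiv.Perm.sign (permGal W two_ne_zero σ) = 1 :=
    (sign_permGal_eq_one_iff hℓ hℓ2 hℓΔ (primesEquiv_eq_of_natCast_mem hℓ hv) h𝔓 hσ).mpr hsq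
  obtain ⟨P, hP⟩ := hmove
  obtain ⟨Q, hQ0, hQ⟩ := hfix
  have hP0 : P ≠ 0 := by rintro rfl; exact hP (smul_zero σ)
  obtain ⟨i, rfl⟩ := (eq_zero_or_eq_T W two_ne_zero P).resolve_left hP0
  obtain ⟨j, rfl⟩ := (eq_zero_or_eq_T W two_ne_zero Q).resolve_left hQ0
  have hi : permGal W two_ne_zero σ i ≠ i := by
    intro h; apply hP; rw [← T_permGal, h]
  have hj : permGal W two_ne_zero σ j = j := by
    apply T_injective W two_ne_zero; rw [T_permGal, hQ]
  have := perm_three_sign_eq_neg_one_of_move_of_fix _ ⟨i, hi⟩ ⟨j, hj⟩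
  rw [h1] at this
  exact absurd this (by decide)

omit [W.IsElliptic] in
/-- For a globally minimal model the line's registered filter `OffBigImageOddLocalAtTwo.RegularAtTwo` (`…OffBigImageOddLocalDefs.lean`,
`¬ IsSquare (Δ.num·Δ.den mod ℓ)`) reads `¬ IsSquare (Δ_min mod ℓ)`. -/
theorem regularAtTwo_iff (ℓ : ℕ) :
    RegularAtTwo W ℓ ↔ ¬ IsSquare ((minimalDiscriminantInt W : ℤ) : ZMod ℓ) := by
  unfold RegularAtTwo
  rw [← cast_minimalDiscriminantInt W, Rat.num_intCast, Rat.den_intCast]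
  simp

end SignLegendre

end DictionaryA

end Summit.BirchSwinnertonDyer.BirchSwinnertonDyer.Theorems.OffBigImageOddLocalAtTwo.Engine

end
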